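import Mathlib
import Literature.Computability.Complexity.Classes
import Literature.Computability.Complexity.Circuit
import Literature.Computability.Complexity.CircuitClasses
import Literature.Computability.Complexity.UniformCircuitClasses
import Literature.Computability.Complexity.Oracle
import Literature.Computability.Complexity.ParityQuantifier
import Literature.Computability.Complexity.Promise
import Literature.Computability.MetaComplexity.MCSP
import Literature.Computability.MetaComplexity.TruthTables
import Literature.Computability.MetaComplexity.AtseriasMuller2025.GeneralMagnification
import HarnessLib

/-!
# Atserias–Müller 2025, Theorem 11 / Theorem 27 (uniform hardness magnification: `n^{−ε}-MCSP[σ]`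
# versus P-uniform circuits of size `n^{1+ε+o(1)}` ⇒ `P ≠ NP^{⊕P}`) — as named facts
# (census row R13)

Source: A. Atserias, M. Müller, *Simple general magnification of circuit lower bounds*,
arXiv:2503.24061 (2025), bib key `AtseriasMuller2025`.  Held LaTeX-source text
`lit read paper:arxiv-2503.24061` (chunks `p0003` §1 conventions and `ε-MCSP[σ]`, `p0005` Thm. 11
and the discussion after it, `p0012`–`p0013` §5 "Uniform magnification": Thm. 25, Cor. 26, §5.2
Thm. 27 with proof).  Companion of `GeneralMagnification.lean` (Thm. 24, rows R11/R12), whose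
`farFrom` (`ε-Q`), `gapParam` (`n^{−ε}`) and `hammingList` are reused.

## The printed statements (verbatim, with locators in the held text)

Conventions (§1, `p0003` L3–4): *"by a circuit (resp. formula) we mean one with inner gates labeled
¬, ∧, ∨ of fan-in at most 2 (and, resp., of fan-out at most 1); its size is the number of gates. A
promise problem is given by disjoint sets YES and NO of binary strings. It is contained in SIZE[s]
(resp. FML[s]), where `s : ℕ → ℕ`, if for all sufficiently large `n ∈ ℕ` there is a circuit (resp.
formula) `Cₙ` of size `≤ s(n)` that accepts all n-bit strings in YES and rejects all n-bit strings in
NO. The class P-uniform-SIZE[s] additionally requires the map `n ↦ Cₙ` to be computable in time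
polynomial in `n`."*  (`p0003` L19) *"MCSP[σ] — Instance: `x ∈ {0,1}ⁿ` with `n = 2^ℓ` for some
`n, ℓ ∈ ℕ`. Problem: is `x` computable by a circuit of size `≤ σ(ℓ)`?"*  (`p0003` L39–45) *"ε-MCSP[σ]
— Instance: `x ∈ {0,1}ⁿ` with `n = 2^ℓ` … YES: `x` is computable by a circuit of size `≤ σ(ℓ)`.
NO: `d_H(x,y) ≥ ε(n)·n` for all `y ∈ {0,1}ⁿ` computable by a circuit of size `≤ σ(ℓ)`. … Observe,
the smaller ε, the more NO instances, the harder the problem"*.  (§4, `p0010` L62: the circuits for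
truth tables may read "the input gates and the constant 1".)

**Theorem 11** (§1.4, `p0005` L42–45): *"`P ≠ NP^{⊕P}` if there exist a real `ε > 0` and a function
`σ(ℓ) ≤ 2^{o(ℓ)}` such that `n^{−ε}-MCSP[σ] ∉ P-uniform-SIZE[n^{1+ε+o(1)}]`."*
(`p0005` L47–48) *"This magnification threshold can be judged “almost known” because Santhanam and
Williams [sw] showed `P ⊄ P-uniform-SIZE[n^c]` for all `c ∈ ℕ`."*  (`p0005` L50–53) *"Theorem 11 is
interesting in that is seems to sidestep the localization barrier: [CHOPRS] shows that many lower
bound techniques localize … But Santhanam and Williams' proof does not seem to localize."*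

**Theorem 27** (§5.2 "Adding uniformity", `p0012` L76; "The following implies Theorem 11"): *"For all
reals `δ, ε > 0` there is a real `γ > 0` such that for all `σ : ℕ → ℝ_{≥0}` with `σ(ℓ) ≤ 2^{γℓ}`, if
`n^{−ε}-MCSP[σ] ∉ P-uniform-SIZE[n^{1+ε+δ}]`, then `P ≠ NP^{⊕P}`."*  Proof (`p0012` L78 – `p0013` L6):
assume `P = NP^{⊕P}`; the kernel `K` of §5.1 is then in `P`, hence in `P-uniform-SIZE[n^c]`; Lemma 23
gives probabilistic formulas `K_{O(n^{2γ} log n)} ∘ XOR_{O(n^ε log n)}` for `n^{−ε}-MCSP[σ]`; an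
`n`-fold conjunction of independent copies errs on NO instances with probability `< 2^{−n}`, a good
seed tuple is found in polynomial time with a PH oracle, and `PH = P` under the assumption; replacing
the oracle gates by the uniform circuits for `K` gives a P-uniform circuit of size
`O(n · (n^{2γ} log n)^c · n^ε log n) ≤ n^{1+δ+ε}`.

## Rendering (each choice makes the typed facts WEAKER than or equal to the printed theorem; the
## typed HYPOTHESES imply the printed ones, the typed CONCLUSION is the printed one)

(i) *Circuits and the size slack.*  The tree's `MCSPSize s` measures truth tables by circuits over
`B2` (ALL gates of fan-in `≤ 2`, constants as arity-0 gates, size = number of gates,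
`circuitSizeOver B2`), print's `MCSP[σ]` by `{¬, ∧, ∨}`-circuits of fan-in `≤ 2` with the constant `1`
available as an input.  Gate by gate, AM-size `≤ 4 ·` B₂-size (the worst binary gates, `⊕` and `≡`,
cost four De Morgan gates: `x ⊕ y = (x ∨ y) ∧ ¬(x ∧ y)`), and B₂-size `≤` AM-size `+ 1` (one arity-0
gate for the constant `1`).  A THRESHOLD hypothesis "`n^{−ε}-MCSP[σ] ∉ 𝒞`" is therefore typed over
the TWO-PARAMETER promise problem `apxMCSP ε s s' := ⟨MCSPSize s, NO(ε-MCSPSize s')⟩` with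
`s' = noSlack s = 4s + 4`: with `σ := 4s` one has `YES_typed = MCSP_{B₂}[s] ⊆ YES_AM(σ)` and
`{y : AM-size(y) ≤ σ} ⊆ MCSP_{B₂}[4s+1] ⊆ MCSP_{B₂}[4s+4]`, so `NO_typed ⊆ NO_AM(σ)` at every length
`n = 2^ℓ` (same distance `ε(n)·n`, same "all `y` of the same length").  At lengths that are NOT powers
of two print has NO INSTANCES at all (its instance condition is `n = 2^ℓ`), while the typed problem
has `YES = ∅` and `NO =` everything there (the `farFrom` condition is vacuous over the empty
`MCSPSize` slice) — a length decided by a constant-`0` gate, which (v) keeps inside the typed class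
(size `1`, printable in polynomial time).  At the lengths `n = 2^ℓ` the typed problem is thus EASIER
than print's (every decider of print's problem decides it), and altogether "typed problem `∉ 𝒞`"
IMPLIES "print's problem `∉ 𝒞`" (referee r19 F33 wording).
(ii) *The class.*  `PUniformSIZE t` is typed in the shape of `FML` (`GeneralMagnification.lean`): a
family `C : CircuitFamily` over `B2` with `|C n| ≤ t n` and correct on the YES/NO instances of every
length `n ≥ n₀` (print: "for all sufficiently large n").  P-UNIFORMITY is rendered WITHOUT choosing
an encoding of circuits, through the tree's direct-connection-language uniformity
(`CircuitFamily.IsDCUniform`, Vollmer 1999 Def. 2.24/4.28, tuples `(n, a, p, b)` in binary): the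
family is `E`-DCL-uniform, `C.IsDCUniform E` with `E = ⋃_c DTIME(2^{c m})` in the tuple length `m`.
Since `m ≥ |bin n| ≥ log₂ n`, a family whose circuits `Cₙ` (of polynomial size) are printed by a
polynomial-time machine has its connection tuples decided in time `poly(n) ≤ 2^{O(m)}` (compute `Cₙ`,
look the tuple up; renumber the gates admissibly, `CircuitFamily.IsAdmissible`, padding the output
with one identity gate if it is an input wire — `+1` gate), so every printed P-uniform family of
size `≤ t` is a typed family of size `≤ t + 2` (conversely an `E`-uniform DCL of a polynomial-size
family lets one print `Cₙ` in polynomial time by querying all `poly(n)` tuples, so for polynomial `t`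
the typed class IS P-uniform-SIZE up to the `+O(1)`).  The typed class CONTAINS print's — the safe
direction for a `∉`-hypothesis; the additive `+2` and the factor-4 slack of (i) are absorbed below.
(iii) *Exponents.*  `n^{1+ε+δ}` is rounded up (`thresholdU ε δ n = ⌈n^{1+ε+δ}⌉₊`: bigger class,
stronger hypothesis); "`σ(ℓ) ≤ 2^{γℓ}`" is read for ALL `ℓ` (`ExpBounded γ s`; fewer admissible `s`,
weaker typed theorem); in Theorem 11, "`σ(ℓ) ≤ 2^{o(ℓ)}`" is `SubexpParam s` (`∀ γ > 0`, eventually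
`s ℓ ≤ 2^{γℓ}`) and "`∉ P-uniform-SIZE[n^{1+ε+o(1)}]`" is read as the STRONGER `∃ δ > 0, ∉
P-uniform-SIZE[n^{1+ε+δ}]` (it implies non-membership in `SIZE[n^{1+ε+e(n)}]` for every `e(n) → 0`,
the classes being almost-everywhere classes; for uniform classes the converse reading is not
automatic, so the typed hypothesis is the stronger one — safe).
(iv) *Conclusion.*  `P ≠ NP^{⊕P}` is typed LITERALLY as `Classes.P ≠ NPRelClass ParityP`
(`Oracle.lean`: `NPRelClass C = ⋃_{L ∈ C} NP^L`; `ParityQuantifier.lean`: `ParityP = ⊕·P`).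
(v) *Why the typed `thm27` follows from the printed Theorem 27.*  Given `δ, ε > 0`, apply print with
`(δ/2, ε)` to get `γ₀ > 0` and put `γ := γ₀/2`.  Let `s` satisfy `s ℓ ≤ 2^{γℓ}` for all `ℓ`, and put
`σ(ℓ) := 4 s(ℓ)` for `ℓ ≥ ℓ₀ := ⌈4/γ₀⌉` (then `σ(ℓ) ≤ 2^{γ₀ℓ}`) and `σ(ℓ) := 0` below.  If the typed
hypothesis held while print's failed, a P-uniform `{¬,∧,∨}`-family of size `≤ n^{1+ε+δ/2}` would
decide `n^{−ε}-MCSP[σ]` at all large lengths, hence (by (i), at all lengths `n = 2^ℓ ≥ 2^{ℓ₀}`, and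
at the other lengths — where the typed problem has only NO instances — by swapping in a constant-`0`
gate, a P-uniform modification) the typed problem `apxMCSP (gapParam ε) s (noSlack s)`, and by (ii)
it is a typed family of size `≤ n^{1+ε+δ/2} + 2 ≤ ⌈n^{1+ε+δ}⌉₊` for large `n` — contradicting the
typed hypothesis.  So the typed hypothesis implies print's hypothesis (for `σ`, which satisfies
print's growth condition), and print gives `P ≠ NP^{⊕P}`.  `thm11_of_thm27` (PROVED below) then
derives the typed Theorem 11 from the typed Theorem 27 exactly as print says ("The following implies
Theorem 11"): a parameter `s ≤ 2^{o(ℓ)}` is modified below `ℓ₀` to meet `ExpBounded γ`, which changes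
the promise problem at finitely many lengths only (`HypothesisU.congr`).
(vi) *Not typed.*  The "almost known" side (`p0005` L47–48: Santhanam–Williams, *On uniformity and
circuit lower bounds*, Comput. Complexity 23 (2014), doi:10.1007/s00037-014-0087-y — `P ⊄
P-uniform-SIZE[n^c]` for every `c`, for SOME language in `P`) is a bound for a DIFFERENT problem, not
for `n^{−ε}-MCSP[σ]`: the census records R13 as THRESHOLD-ONLY (problem mismatch), no number.
Theorem 25 / Corollary 26 (`⊕P ⊄ NC` from `PFML` lower bounds) belong to rows R11/R12's model and are
not typed here.
-/

namespace Literature.Computability.MetaComplexity.AtseriasMuller2025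

open Filter Literature.Computability.Complexity Literature.Computability.MetaComplexity

/-! ### D — P-uniform size classes of promise problems; the two-parameter `n^{−ε}-MCSP` -/

/-- **`P-uniform-SIZE[t]`** for promise problems (Atserias–Müller 2025, §1, `p0003` L3–4), typed as:
some circuit family `C` over `B2` with `|C n| ≤ t n` for `n ≥ n₀`, whose direct connection language
is in `E` (`CircuitFamily.IsDCUniform E` — P-uniformity for polynomial `t`, rendering note (ii)),
accepts every YES instance and rejects every NO instance of each length `n ≥ n₀`.  The typed class
contains the printed one. [cite: AtseriasMuller2025, §1 (P-uniform-SIZE, p. 1)] -/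
def PUniformSIZE (t : ℕ → ℕ) : Set PromiseProblem :=
  {P | ∃ C : CircuitFamily, ∃ n₀ : ℕ,
    (∀ n ≥ n₀, (C n).IsOver B2 ∧ (C n).size ≤ t n) ∧ C.IsDCUniform E ∧
    ∀ x : List Bool, n₀ ≤ x.length →
      (x ∈ P.yes → (C x.length).eval x.get = true) ∧ (x ∈ P.no → (C x.length).eval x.get = false)}

/-- **`apxMCSP ε s s'`** — the two-parameter approximation version of `MCSP`: YES = truth tables of
`B2`-circuit complexity `≤ s(ℓ)` (`MCSPSize s`); NO = strings `x` with `d_H(x, y) ≥ ε(|x|)·|x|` for every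
`y ∈ MCSPSize s'` of the same length (the NO part of `farFrom (MCSPSize s') ε`).  With `s' = noSlack s`
this is the tree rendering of print's `ε-MCSP[4s]` from BELOW (rendering note (i)).
[cite: AtseriasMuller2025, §1.4 (ε-MCSP[σ], p. 1)] -/
def apxMCSP (ε : ℕ → ℝ) (s s' : ℕ → ℕ) : PromiseProblem :=
  ⟨MCSPSize s, (farFrom (MCSPSize s') ε).no⟩

/-- The NO-side size parameter `4·s + 4` absorbing the `B2` ↔ `{¬,∧,∨}+1` size conventions (note (i)).
[folklore] -/
def noSlack (s : ℕ → ℕ) : ℕ → ℕ := fun ℓ => 4 * s ℓ + 4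

/-- The size threshold `n^{1+ε+δ}`, rounded up. [cite: AtseriasMuller2025, Thm. 27 (parameters)] -/
noncomputable def thresholdU (ε δ : ℝ) (n : ℕ) : ℕ := ⌈(n : ℝ) ^ (1 + ε + δ)⌉₊

/-- Print's growth condition of Theorem 27, "`σ(ℓ) ≤ 2^{γℓ}`", read for all `ℓ`.
[cite: AtseriasMuller2025, Thm. 27 (hypothesis on σ)] -/
def ExpBounded (γ : ℝ) (s : ℕ → ℕ) : Prop :=
  ∀ ℓ : ℕ, (s ℓ : ℝ) ≤ (2 : ℝ) ^ (γ * ℓ)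

/-- Print's growth condition of Theorem 11, "`σ(ℓ) ≤ 2^{o(ℓ)}`": for every `γ > 0`, eventually
`s ℓ ≤ 2^{γℓ}`. [cite: AtseriasMuller2025, Thm. 11 (hypothesis on σ)] -/
def SubexpParam (s : ℕ → ℕ) : Prop :=
  ∀ γ : ℝ, 0 < γ → ∀ᶠ ℓ : ℕ in atTop, (s ℓ : ℝ) ≤ (2 : ℝ) ^ (γ * ℓ)

/-- **The hypothesis of Theorem 27 at `(ε, δ, s)`**: `n^{−ε}-MCSP ∉ P-uniform-SIZE[n^{1+ε+δ}]` in the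
tree rendering (two-parameter problem, notes (i)–(iii)).  OPEN; recorded, not asserted.
[cite: AtseriasMuller2025, Thm. 27 (hypothesis)] -/
def HypothesisU (ε δ : ℝ) (s : ℕ → ℕ) : Prop :=
  apxMCSP (gapParam ε) s (noSlack s) ∉ PUniformSIZE (thresholdU ε δ)

/-- **The conclusion `P ≠ NP^{⊕P}`**, literally (`NPRelClass ParityP = ⋃_{L ∈ ⊕P} NP^L`).
[cite: AtseriasMuller2025, Thm. 11 (conclusion)] -/
def PneNPParityP : Prop := Classes.P ≠ NPRelClass ParityP

/-! ### T — the named facts -/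

/-- **Atserias–Müller 2025, Theorem 27** (typed, not proved): *"For all reals δ, ε > 0 there is a real
γ > 0 such that for all σ with σ(ℓ) ≤ 2^{γℓ}, if n^{−ε}-MCSP[σ] ∉ P-uniform-SIZE[n^{1+ε+δ}], then
P ≠ NP^{⊕P}."*  The typed hypothesis implies the printed one (notes (i)–(iii), derivation (v)), the
conclusion is the printed one (iv).  Users take `(h : thm27)`.
[cite: AtseriasMuller2025, Thm. 27 (§5.2, p. 10; proof pp. 10–11)] -/
def thm27 : Prop :=
  ∀ δ ε : ℝ, 0 < δ → 0 < ε → ∃ γ : ℝ, 0 < γ ∧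
    ∀ s : ℕ → ℕ, ExpBounded γ s → HypothesisU ε δ s → PneNPParityP

/-- **Atserias–Müller 2025, Theorem 11** (typed, not proved; PROVED from `thm27` in
`thm11_of_thm27`): *"P ≠ NP^{⊕P} if there exist a real ε > 0 and a function σ(ℓ) ≤ 2^{o(ℓ)} such that
n^{−ε}-MCSP[σ] ∉ P-uniform-SIZE[n^{1+ε+o(1)}]."*  The `o(1)` in the exponent is read as "for some
`δ > 0`" (note (iii), the stronger reading of the hypothesis).
[cite: AtseriasMuller2025, Thm. 11 (§1.4, p. 3)] -/
def thm11 : Prop :=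
  ∀ ε : ℝ, 0 < ε → ∀ s : ℕ → ℕ, SubexpParam s → (∃ δ : ℝ, 0 < δ ∧ HypothesisU ε δ s) → PneNPParityP

/-! ### API (proved) -/

/-- `s ≤ noSlack s` pointwise. [folklore] -/
theorem le_noSlack (s : ℕ → ℕ) (ℓ : ℕ) : s ℓ ≤ noSlack s ℓ := by
  unfold noSlack; omega

/-- **F1 (non-degeneracy).**  A YES instance of `apxMCSP ε s s'` is never a NO instance when `s ≤ s'`
and `ε(n)·n > 0` at positive lengths: truth tables have positive length and distance `0` to
themselves. [folklore] -/
theorem apxMCSP_yes_not_no {ε : ℕ → ℝ} {s s' : ℕ → ℕ} (hs : ∀ ℓ, s ℓ ≤ s' ℓ)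
    (hε : ∀ n : ℕ, 0 < n → 0 < ε n * n) {x : List Bool} (hx : x ∈ (apxMCSP ε s s').yes) :
    x ∉ (apxMCSP ε s s').no := by
  have hx' : x ∈ MCSPSize s' := MCSPSize_mono hs hx
  have hlen : 0 < x.length := by
    obtain ⟨n, f, rfl, -⟩ := hx'
    simp [length_truthTable]
  exact farFrom_yes_not_no (Q := MCSPSize s') (hε _ hlen) hx'

/-- The two parts of `apxMCSP (gapParam ε) s (noSlack s)` are disjoint. [folklore] -/
theorem apxMCSP_disjoint (ε : ℝ) (s : ℕ → ℕ) :
    (apxMCSP (gapParam ε) s (noSlack s)).Disjoint := by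
  refine Set.disjoint_left.2 ?_
  intro x hx
  exact apxMCSP_yes_not_no (le_noSlack s) (fun n hn => gapParam_mul_pos ε hn) hx

/-- `PUniformSIZE` is monotone in the size bound (eventual comparison suffices). [folklore] -/
theorem PUniformSIZE_mono {t t' : ℕ → ℕ} (h : ∃ n₁ : ℕ, ∀ n ≥ n₁, t n ≤ t' n) :
    PUniformSIZE t ⊆ PUniformSIZE t' := by
  rintro P ⟨C, n₀, hC, hU, hx⟩
  obtain ⟨n₁, hn₁⟩ := h
  refine ⟨C, max n₀ n₁, fun n hn => ⟨(hC n (le_of_max_le_left hn)).1,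
    (hC n (le_of_max_le_left hn)).2.trans (hn₁ n (le_of_max_le_right hn))⟩, hU,
    fun x hxn => hx x (le_of_max_le_left hxn)⟩

/-- **Almost-everywhere invariance.**  If beyond some length every YES (resp. NO) instance of `Q` is a
YES (resp. NO) instance of `P`, then `P ∈ PUniformSIZE t` implies `Q ∈ PUniformSIZE t` (the same family
works). [folklore] -/
theorem PUniformSIZE_of_imp {t : ℕ → ℕ} {P Q : PromiseProblem} (L : ℕ)
    (hyes : ∀ x : List Bool, L ≤ x.length → x ∈ Q.yes → x ∈ P.yes)
    (hno : ∀ x : List Bool, L ≤ x.length → x ∈ Q.no → x ∈ P.no)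
    (hP : P ∈ PUniformSIZE t) : Q ∈ PUniformSIZE t := by
  obtain ⟨C, n₀, hC, hU, hx⟩ := hP
  refine ⟨C, max n₀ L, fun n hn => hC n (le_of_max_le_left hn), hU, fun x hxn => ?_⟩
  exact ⟨fun hy => (hx x (le_of_max_le_left hxn)).1 (hyes x (le_of_max_le_right hxn) hy),
    fun hn => (hx x (le_of_max_le_left hxn)).2 (hno x (le_of_max_le_right hxn) hn)⟩

/-- Membership in `MCSP[s]` of a string of length `≥ 2^{ℓ₀}` only depends on `s` at arities `≥ ℓ₀`.
[folklore] -/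
theorem mem_MCSPSize_of_eqOn {s s' : ℕ → ℕ} {ℓ₀ : ℕ} (h : ∀ ℓ, ℓ₀ ≤ ℓ → s ℓ = s' ℓ)
    {x : List Bool} (hx : 2 ^ ℓ₀ ≤ x.length) (hmem : x ∈ MCSPSize s) : x ∈ MCSPSize s' := by
  obtain ⟨n, f, rfl, hf⟩ := hmem
  have hn : ℓ₀ ≤ n := by
    rw [length_truthTable] at hx
    exact (Nat.pow_le_pow_iff_right (by norm_num)).1 hx
  exact ⟨n, f, rfl, (h n hn) ▸ hf⟩

/-- **`HypothesisU` only depends on `s` at large arities**: parameters that agree from `ℓ₀` on give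
the same promise problem beyond length `2^{ℓ₀}`, hence the same (non-)membership. [folklore] -/
theorem HypothesisU.congr {ε δ : ℝ} {s s' : ℕ → ℕ} {ℓ₀ : ℕ} (h : ∀ ℓ, ℓ₀ ≤ ℓ → s ℓ = s' ℓ)
    (hs : HypothesisU ε δ s) : HypothesisU ε δ s' := by
  intro hmem
  apply hs
  have h' : ∀ ℓ, ℓ₀ ≤ ℓ → s' ℓ = s ℓ := fun ℓ hℓ => (h ℓ hℓ).symm
  have hS : ∀ ℓ, ℓ₀ ≤ ℓ → noSlack s ℓ = noSlack s' ℓ := fun ℓ hℓ => by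
    simp only [noSlack, h ℓ hℓ]
  refine PUniformSIZE_of_imp (2 ^ ℓ₀) (fun x hx hy => mem_MCSPSize_of_eqOn h hx hy) ?_ hmem
  intro x hx hno y hy hlen
  exact hno y (mem_MCSPSize_of_eqOn (fun ℓ hℓ => (hS ℓ hℓ).symm) (hlen ▸ hx) hy) hlen

/-- Truncating a parameter below `ℓ₀`: `s₀ ℓ = s ℓ` for `ℓ ≥ ℓ₀`, `0` below. [folklore] -/
def truncBelow (ℓ₀ : ℕ) (s : ℕ → ℕ) : ℕ → ℕ := fun ℓ => if ℓ₀ ≤ ℓ then s ℓ else 0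

/-- The truncated parameter agrees with `s` from `ℓ₀` on. [folklore] -/
theorem truncBelow_eq {ℓ₀ : ℕ} {s : ℕ → ℕ} (ℓ : ℕ) (h : ℓ₀ ≤ ℓ) : truncBelow ℓ₀ s ℓ = s ℓ := by
  simp [truncBelow, h]

/-- An eventually-`2^{γℓ}`-bounded parameter, truncated, is `2^{γℓ}`-bounded everywhere. [folklore] -/
theorem expBounded_truncBelow {γ : ℝ} {s : ℕ → ℕ} {ℓ₀ : ℕ}
    (h : ∀ ℓ ≥ ℓ₀, (s ℓ : ℝ) ≤ (2 : ℝ) ^ (γ * ℓ)) : ExpBounded γ (truncBelow ℓ₀ s) := by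
  intro ℓ
  by_cases hℓ : ℓ₀ ≤ ℓ
  · rw [truncBelow_eq ℓ hℓ]
    exact h ℓ hℓ
  · simp only [truncBelow, if_neg hℓ, Nat.cast_zero]
    exact (Real.rpow_pos_of_pos (by norm_num) _).le

/-- **Theorem 11 from Theorem 27** (as print says: "The following implies Theorem 11"): a parameter
`σ ≤ 2^{o(ℓ)}` eventually satisfies `σ(ℓ) ≤ 2^{γℓ}` for the `γ` of Theorem 27, and modifying it at
finitely many arities does not change the hypothesis (`HypothesisU.congr`).
[cite: AtseriasMuller2025, §5.2 ("The following implies Theorem 11")] -/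
theorem thm11_of_thm27 (h : thm27) : thm11 := by
  intro ε hε s hsub ⟨δ, hδ, hyp⟩
  obtain ⟨γ, hγ, hmain⟩ := h δ ε hδ hε
  obtain ⟨ℓ₀, hℓ₀⟩ := eventually_atTop.1 (hsub γ hγ)
  refine hmain (truncBelow ℓ₀ s) (expBounded_truncBelow hℓ₀) ?_
  exact HypothesisU.congr (ℓ₀ := ℓ₀) (fun ℓ hℓ => (truncBelow_eq ℓ hℓ).symm) hyp

/-- `thresholdU` is monotone in `δ` (at every `n`, rounding included). [folklore] -/
theorem thresholdU_mono {ε δ δ' : ℝ} (hpos : 0 < 1 + ε + δ) (h : δ ≤ δ') (n : ℕ) :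
    thresholdU ε δ n ≤ thresholdU ε δ' n := by
  unfold thresholdU
  apply Nat.ceil_mono
  rcases Nat.eq_zero_or_pos n with rfl | hn
  · have hpos' : 0 < 1 + ε + δ' := lt_of_lt_of_le hpos (by linarith)
    simp [Real.zero_rpow (ne_of_gt hpos), Real.zero_rpow (ne_of_gt hpos')]
  · exact Real.rpow_le_rpow_of_exponent_le (by exact_mod_cast hn) (by linarith)

/-- **`HypothesisU` is antitone in `δ`**: a lower bound against the bigger class `n^{1+ε+δ'}` gives the
one against `n^{1+ε+δ}` for `δ ≤ δ'`. [folklore] -/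
theorem HypothesisU.anti {ε δ δ' : ℝ} (hpos : 0 < 1 + ε + δ) (h : δ ≤ δ') {s : ℕ → ℕ}
    (hs : HypothesisU ε δ' s) : HypothesisU ε δ s := fun hmem =>
  hs (PUniformSIZE_mono ⟨0, fun n _ => thresholdU_mono hpos h n⟩ hmem)

end Literature.Computability.MetaComplexity.AtseriasMuller2025
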